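import Mathlib

/-!
# Crux `MustSqueeze` (stmt-NavierStokesRegularity-11610), negative side: load-bearing map of the lead's abstract two-pass Grönwall stub

Negative-side (cdisprove, D-0016) lemmas extracted from `Cruxes/MustSqueeze/Disproof.lean` v10 (§8).
The picked line `outward-drift-signed-flux` (lead skeleton v1,
`Cruxes/MustSqueeze/Lines/outward-drift-signed-flux.lean`) ends in an abstract real-analysis stub
`stub_twoPassGronwall` over two families `Z E : ℝ → ℝ → ℝ` (localised similarity enstrophy at cutoff
radius `R`, ball gradient energy at radius `ρ`).  Its statement is, verbatim (the `Lines/` file is not an importable module),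

```
∀ (c κ κ' B : ℝ) (Z E : ℝ → ℝ → ℝ), 0 < c →
  (∀ ρ s, 0 < ρ → 0 ≤ E ρ s) →                                   -- (E0)
  (∀ ρ, 0 < ρ → Continuous (E ρ)) →                              -- (Ec)
  (∀ s ρ ρ', 0 < ρ → ρ ≤ ρ' → E ρ s ≤ E ρ' s) →                  -- (Emono)
  (∀ s ρ, 1 ≤ ρ → ∫ σ in s..(s + 1), E ρ σ ≤ B * ρ) →            -- (Eavg)   time average, H5b
  (∀ R, 1 ≤ R → Differentiable ℝ (Z R) ∧ ∃ K, Continuous K ∧ (∀ s, 0 ≤ K s) ∧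
    (∀ s, K s ≤ κ * (E (2R) s / R + √(E (2R) s / R))) ∧
    ∀ s, deriv (Z R) s ≤ -c * Z R s + K s) →                     -- (budget) the lever
  (∀ R s, 1 ≤ R → 0 ≤ Z R s) →                                   -- (Z0)
  (∀ R R' s, 1 ≤ R → R ≤ R' → Z R s ≤ Z R' s) →                  -- (Zmono)
  (∀ R s, 1 ≤ R → Z R s ≤ 6 * E (2R) s) →                        -- (good)   good times
  (∀ R s, 1 ≤ R → E R s ≤ Z R s + κ' * √(E (2R) s / R)) →        -- (comp)   div–curl comparison
  ∀ ρ s, 0 < ρ → E ρ s = 0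
```

and its hypotheses are sorted:

* LOAD-BEARING, each with an explicit witness — `twoPassGronwall_false_without_goodTimes` (drop
  `Z R ≤ 6E(2R)`: `Z = e^{−s}`, `E = min(1, e^{−s})`), `twoPassGronwall_false_without_timeAverage`
  (drop `∫_s^{s+1} E ρ ≤ Bρ`: `Z = E = e^{−s}`), `twoPassGronwall_false_without_comparison` (drop
  `E R ≤ Z R + κ'√(E(2R)/R)`: `Z ≡ 0`, `E ≡ 1`) — the backward-exponential mode `e^{−s}` is exactly
  what ancientness + time-averaged bounds (H5b) must exclude;
* REMOVABLE (never used by the two-pass argument, information for the lead — each removal also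
  simplifies an upstream stub): (Z0) — good times come from the unit averages
  `∫Z R ≤ 6∫E(2R) ≤ 12BR` whatever the sign, and the last step bounds `∫E R ≤ ∫Z R + |κ'|√(K₂/R)`
  from above only; (Zmono) (= conclusion (d) of `stub_divCurlBalls`) — (Emono) alone carries the
  limit `R → ∞`, since `∫_s^{s+1} E ρ ≤ ∫_s^{s+1} E R` for `ρ ≤ R`; continuity of `K` (in
  `stub_signedBudget` too) — only `deriv (Z R) ≤ −cZ R + g` with the CONTINUOUS majorant
  `g = κ⁺(E(2R)/R + √(E(2R)/R))` is ever integrated.  The stub itself is TRUE (two backward-Grönwall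
  passes with `L¹_unif` forcing, tree `Theorems.backward_gronwall_bound`; drefute evidence
  `finiteEnstrophy_abstract` is pass 1).

Pure real analysis over Mathlib; no statement of the route is changed (`--supports`).
-/

noncomputable section

namespace Summit.NavierStokesRegularity.NavierStokesRegularity.Theorems.MustSqueeze.Negative

open Set Filter Topology

/-! ## Load-bearing hypotheses of the abstract two-pass Grönwall stub -/

namespace Targets

/-- The backward exponential `e^{−s}`: derivative and the damped law with `c = 1`, `K = 0`. -/
theorem hasDerivAt_exp_neg (s : ℝ) : HasDerivAt (fun s => Real.exp (-s)) (-Real.exp (-s)) s := by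
  simpa using (hasDerivAt_neg s).exp

/-- `(e^{−s})' = −e^{−s}`. -/
theorem deriv_exp_neg (s : ℝ) : deriv (fun s => Real.exp (-s)) s = -Real.exp (-s) :=
  (hasDerivAt_exp_neg s).deriv

/-- `s ↦ e^{−s}` is differentiable. -/
theorem differentiable_exp_neg : Differentiable ℝ (fun s : ℝ => Real.exp (-s)) :=
  fun s => (hasDerivAt_exp_neg s).differentiableAt

/-- The zero forcing satisfies the budget clause for `Z R = e^{−s}`, `c = 1`, `κ = 0`. -/
theorem budget_exp_neg (E : ℝ → ℝ → ℝ) (R : ℝ) :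
    Differentiable ℝ (fun s : ℝ => Real.exp (-s)) ∧ ∃ K : ℝ → ℝ, Continuous K ∧ (∀ s, 0 ≤ K s) ∧
      (∀ s, K s ≤ 0 * (E (2 * R) s / R + Real.sqrt (E (2 * R) s / R))) ∧
      ∀ s, deriv (fun s : ℝ => Real.exp (-s)) s ≤ -1 * Real.exp (-s) + K s := by
  refine ⟨differentiable_exp_neg, fun _ => 0, continuous_const, fun _ => le_rfl, fun s => by simp,
    fun s => ?_⟩
  rw [deriv_exp_neg]; simp

/-- Unit-time integral of a function bounded by `1`. -/
theorem intervalIntegral_le_one_of_le_one {f : ℝ → ℝ} (hf : Continuous f) (h1 : ∀ σ, f σ ≤ 1)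
    (s : ℝ) : ∫ σ in s..(s + 1), f σ ≤ 1 := by
  have h : ∫ σ in s..(s + 1), f σ ≤ ∫ σ in s..(s + 1), (1 : ℝ) :=
    intervalIntegral.integral_mono_on (by linarith) (hf.intervalIntegrable _ _)
      (continuous_const.intervalIntegrable _ _) (fun σ _ => h1 σ)
  simpa using h

/-- **Good times are load-bearing.**  `stub_twoPassGronwall` with (good) `Z R ≤ 6E(2R)` DELETED
(the only clause tying `Z` to a time-averaged quantity, i.e. the source of the "good times" of
pass 1) is FALSE: `Z R s = e^{−s}` (backward-exponentially growing, exactly the mode ancient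
Grönwall must exclude), `E ρ s = min(1, e^{−s})`, `c = 1`, `κ = κ' = 0`, `B = 1`. -/
theorem twoPassGronwall_false_without_goodTimes : ¬ (
    ∀ (c κ κ' B : ℝ) (Z E : ℝ → ℝ → ℝ), 0 < c →
    (∀ (ρ s : ℝ), 0 < ρ → 0 ≤ E ρ s) →
    (∀ ρ : ℝ, 0 < ρ → Continuous (E ρ)) →
    (∀ (s ρ ρ' : ℝ), 0 < ρ → ρ ≤ ρ' → E ρ s ≤ E ρ' s) →
    (∀ (s ρ : ℝ), 1 ≤ ρ → ∫ σ in s..(s + 1), E ρ σ ≤ B * ρ) →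
    (∀ R : ℝ, 1 ≤ R → Differentiable ℝ (Z R) ∧ ∃ K : ℝ → ℝ, Continuous K ∧ (∀ s, 0 ≤ K s) ∧
    (∀ s, K s ≤ κ * (E (2 * R) s / R + Real.sqrt (E (2 * R) s / R))) ∧
    ∀ s, deriv (Z R) s ≤ -c * Z R s + K s) →
    (∀ (R s : ℝ), 1 ≤ R → 0 ≤ Z R s) →
    (∀ (R R' s : ℝ), 1 ≤ R → R ≤ R' → Z R s ≤ Z R' s) →
    (∀ (R s : ℝ), 1 ≤ R → E R s ≤ Z R s + κ' * Real.sqrt (E (2 * R) s / R)) →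
    ∀ (ρ s : ℝ), 0 < ρ → E ρ s = 0) := by
  intro h
  have hEc : Continuous fun s : ℝ => min (1 : ℝ) (Real.exp (-s)) :=
    continuous_const.min (Real.continuous_exp.comp continuous_neg)
  have key := h 1 0 0 1 (fun _ s => Real.exp (-s)) (fun _ s => min 1 (Real.exp (-s))) one_pos
    (fun _ s _ => le_min zero_le_one (Real.exp_pos _).le)
    (fun _ _ => hEc)
    (fun _ _ _ _ _ => le_rfl)
    (fun s ρ hρ => (intervalIntegral_le_one_of_le_one hEc (fun σ => min_le_left _ _) s).trans
      (by linarith))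
    (fun R _ => budget_exp_neg (fun _ s => min 1 (Real.exp (-s))) R)
    (fun _ s _ => (Real.exp_pos _).le)
    (fun _ _ _ _ _ => le_rfl)
    (fun R s _ => by simp)
    1 0 one_pos
  norm_num at key

/-- **The time-averaged bound (H5b) is load-bearing.**  `stub_twoPassGronwall` with (Eavg)
`∫_s^{s+1} E ρ ≤ Bρ` DELETED is FALSE: `Z R s = E ρ s = e^{−s}` satisfies every remaining clause
(`c = 1`, `κ = κ' = 0`). -/
theorem twoPassGronwall_false_without_timeAverage : ¬ (
    ∀ (c κ κ' : ℝ) (Z E : ℝ → ℝ → ℝ), 0 < c →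
    (∀ (ρ s : ℝ), 0 < ρ → 0 ≤ E ρ s) →
    (∀ ρ : ℝ, 0 < ρ → Continuous (E ρ)) →
    (∀ (s ρ ρ' : ℝ), 0 < ρ → ρ ≤ ρ' → E ρ s ≤ E ρ' s) →
    (∀ R : ℝ, 1 ≤ R → Differentiable ℝ (Z R) ∧ ∃ K : ℝ → ℝ, Continuous K ∧ (∀ s, 0 ≤ K s) ∧
    (∀ s, K s ≤ κ * (E (2 * R) s / R + Real.sqrt (E (2 * R) s / R))) ∧
    ∀ s, deriv (Z R) s ≤ -c * Z R s + K s) →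
    (∀ (R s : ℝ), 1 ≤ R → 0 ≤ Z R s) →
    (∀ (R R' s : ℝ), 1 ≤ R → R ≤ R' → Z R s ≤ Z R' s) →
    (∀ (R s : ℝ), 1 ≤ R → Z R s ≤ 6 * E (2 * R) s) →
    (∀ (R s : ℝ), 1 ≤ R → E R s ≤ Z R s + κ' * Real.sqrt (E (2 * R) s / R)) →
    ∀ (ρ s : ℝ), 0 < ρ → E ρ s = 0) := by
  intro h
  have hEc : Continuous fun s : ℝ => Real.exp (-s) := Real.continuous_exp.comp continuous_neg
  have key := h 1 0 0 (fun _ s => Real.exp (-s)) (fun _ s => Real.exp (-s)) one_pos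
    (fun _ s _ => (Real.exp_pos _).le)
    (fun _ _ => hEc)
    (fun _ _ _ _ _ => le_rfl)
    (fun R _ => budget_exp_neg (fun _ s => Real.exp (-s)) R)
    (fun _ s _ => (Real.exp_pos _).le)
    (fun _ _ _ _ _ => le_rfl)
    (fun R s _ => by nlinarith [Real.exp_pos (-s)])
    (fun R s _ => by simp)
    1 0 one_pos
  norm_num at key

/-- **The div–curl comparison is load-bearing.**  `stub_twoPassGronwall` with (comp)
`E R ≤ Z R + κ'√(E(2R)/R)` DELETED is FALSE — nothing ties `E` back to `Z`: `Z ≡ 0`, `E ≡ 1`,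
`c = 1`, `κ = 0`, `B = 1`. -/
theorem twoPassGronwall_false_without_comparison : ¬ (
    ∀ (c κ B : ℝ) (Z E : ℝ → ℝ → ℝ), 0 < c →
    (∀ (ρ s : ℝ), 0 < ρ → 0 ≤ E ρ s) →
    (∀ ρ : ℝ, 0 < ρ → Continuous (E ρ)) →
    (∀ (s ρ ρ' : ℝ), 0 < ρ → ρ ≤ ρ' → E ρ s ≤ E ρ' s) →
    (∀ (s ρ : ℝ), 1 ≤ ρ → ∫ σ in s..(s + 1), E ρ σ ≤ B * ρ) →
    (∀ R : ℝ, 1 ≤ R → Differentiable ℝ (Z R) ∧ ∃ K : ℝ → ℝ, Continuous K ∧ (∀ s, 0 ≤ K s) ∧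
    (∀ s, K s ≤ κ * (E (2 * R) s / R + Real.sqrt (E (2 * R) s / R))) ∧
    ∀ s, deriv (Z R) s ≤ -c * Z R s + K s) →
    (∀ (R s : ℝ), 1 ≤ R → 0 ≤ Z R s) →
    (∀ (R R' s : ℝ), 1 ≤ R → R ≤ R' → Z R s ≤ Z R' s) →
    (∀ (R s : ℝ), 1 ≤ R → Z R s ≤ 6 * E (2 * R) s) →
    ∀ (ρ s : ℝ), 0 < ρ → E ρ s = 0) := by
  intro h
  have key := h 1 0 1 (fun _ _ => 0) (fun _ _ => 1) one_pos
    (fun _ _ _ => zero_le_one)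
    (fun _ _ => continuous_const)
    (fun _ _ _ _ _ => le_rfl)
    (fun s ρ hρ => by simp; linarith)
    (fun R _ => ⟨differentiable_const _, fun _ => 0, continuous_const, fun _ => le_rfl,
      fun s => by simp, fun s => by simp⟩)
    (fun _ _ _ => le_rfl)
    (fun _ _ _ _ _ => le_rfl)
    (fun R s _ => by norm_num)
    1 0 one_pos
  norm_num at key

end Targets

end Summit.NavierStokesRegularity.NavierStokesRegularity.Theorems.MustSqueeze.Negative

end
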